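import Summits.HodgeConjecture.HodgeConjecture.Theorems.Ring2WeilCoverageCMFieldCyclicPrimeRuleSqrtFive
import HarnessLib

/-!
# Ring 2 — Weil-family coverage, CM-field rows: THE COMPLETE RATIONAL PRIME RULE for the cyclic quartic CM fields over
  `F = ℚ(√5)`, II — `ℚ(√-3(5+√5)/2)` (conductor `60`) and `ℚ(ζ₅)` (conductor `5`, b03.16 re-derived)
  (WEIL-FAMILY-COVERAGE «## b03», cell (xxi‴), part 25)

research route conditional on HC_CM; not a corollary; Q11.4-sentence-2 already refuted in dim ≥ 3.

Continuation of part 24 (Deligne's carrier `R = S² + pS + q`, rows `δ ∈ F^×/Nm_{E/F}(E^×)` labelled by their `T`-sets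
[cite: Deligne1982HodgeCycles, §4 p. 30, (1), Cor. 4.2]): inert primes by part 21, split primes by the root character
(parts 22–23), the primes `ℓ ∣ 2q` at the ramified place `(√5)` [cite: Omeara1963, §63B Cor. 63:11a and Example 63:12].
* §64 **`E = ℚ(√-3(5+√5)/2)`, `R = S² + 15S + 45`: for EVERY prime `ℓ` and even `k`,
  `[ℓ] ≠ [1] ⟺ ℓ ≠ 5 ∧ ℓ mod 60 ∉ {1, 11, 19, 29}`** (`= Gal(ℚ(ζ₆₀)/E)`; `[2], [3] ≠ [1]` at `(√5)`, `[5] = [1]`).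
* §65 **`E = ℚ(ζ₅)`, `R = S² + 5S + 5`: `[ℓ] = [1] ⟺ ℓ = 5 ∨ ℓ ≡ 1 (mod 5)`** — b03.16's classification (there by
  Thue's lemma, the quartic norm form and peeling) re-derived by the uniform local route, for every even `k`.
No new definition, no named fact, no sorry; nothing about the Hodge conjecture is asserted.
-/

noncomputable section

set_option linter.dupNamespace false

open Polynomial NumberField IsDedekindDomain

namespace Summit.HodgeConjecture.HodgeConjecture.Ring2.WeilCoverageCM

open Literature.AlgebraicGeometry.Deligne1982
open Literature.AlgebraicGeometry.HodgeTheory (splitDiscriminantClassCM)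
open Literature.NumberTheory.QuadraticForms

variable {R : Polynomial ℤ} [Fact (Irreducible (cmPolyQ R))] [Fact (Irreducible (realPolyQ R))]

/-! ### §64 `E = ℚ(√-3(5+√5)/2)` (`R = S² + 15S + 45`, `F = ℚ(√5)`, conductor `60`): `[ℓ] ≠ [1] ⟺ ℓ ≠ 5 ∧ ℓ mod 60 ∉ H` -/

section Cond60

omit [Fact (Irreducible (cmPolyQ R))] in
/-- `√5 = -(2θ + 15)/3` is an algebraic integer of `F` with square `5`. [folklore] -/
theorem sqrtNegThreeTimesFivePlusSqrtFiveHalf_ratPrimeRule_exists_sq_eq_five (hR : R = X ^ 2 + C 15 * X + C 45) :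
    ∃ s : 𝓞 (realField R), (s : realField R) = -(2 * AdjoinRoot.root (realPolyQ R) + 15) / 3 ∧ s ^ 2 = 5 := by
  have hrel := root_rel_quadratic hR
  push_cast at hrel
  have hsq : (-(2 * AdjoinRoot.root (realPolyQ R) + 15) / 3) ^ 2 = (5 : realField R) := by
    linear_combination (4 / 9 : realField R) * hrel
  have hint : IsIntegral ℤ (-(2 * AdjoinRoot.root (realPolyQ R) + 15) / 3 : realField R) := by
    refine ⟨X ^ 2 - C 5, by monicity!, ?_⟩
    rw [eval₂_sub, eval₂_X_pow, eval₂_C]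
    simp only [eq_intCast, Int.cast_ofNat]
    linear_combination hsq
  refine ⟨⟨_, hint⟩, rfl, ?_⟩
  refine RingOfIntegers.ext ?_
  simp only [map_pow, map_ofNat]
  exact hsq

omit [Fact (Irreducible (cmPolyQ R))] in
/-- The golden integer `ω = (1 + √5)/2 = -(θ + 6)/3 ∈ 𝓞_F`: `ω² = ω + 1`. [folklore] -/
theorem sqrtNegThreeTimesFivePlusSqrtFiveHalf_ratPrimeRule_exists_golden (hR : R = X ^ 2 + C 15 * X + C 45) :
    ∃ s : 𝓞 (realField R), (s : realField R) = -(AdjoinRoot.root (realPolyQ R) + 6) / 3 ∧ s ^ 2 = s + 1 := by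
  have hrel := root_rel_quadratic hR
  push_cast at hrel
  have hsq : (-(AdjoinRoot.root (realPolyQ R) + 6) / 3) ^ 2 = -(AdjoinRoot.root (realPolyQ R) + 6) / 3 + (1 : realField R) := by
    linear_combination (1 / 9 : realField R) * hrel
  have hint : IsIntegral ℤ (-(AdjoinRoot.root (realPolyQ R) + 6) / 3 : realField R) := by
    refine ⟨X ^ 2 - X - C 1, by monicity!, ?_⟩
    rw [eval₂_sub, eval₂_sub, eval₂_X_pow, eval₂_X, eval₂_C]
    simp only [eq_intCast, Int.cast_one]
    linear_combination hsq
  refine ⟨⟨_, hint⟩, rfl, ?_⟩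
  refine RingOfIntegers.ext ?_
  simp only [map_pow, map_add, map_one]
  exact hsq

omit [Fact (Irreducible (cmPolyQ R))] in
/-- **`F = ℚ(√5)` has exactly one dyadic place** (in this carrier's terms). [folklore] -/
theorem sqrtNegThreeTimesFivePlusSqrtFiveHalf_ratPrimeRule_dyadic_unique (hR : R = X ^ 2 + C 15 * X + C 45)
    (v v' : HeightOneSpectrum (𝓞 (realField R))) (h2 : (2 : 𝓞 (realField R)) ∈ v.asIdeal)
    (h2' : (2 : 𝓞 (realField R)) ∈ v'.asIdeal) : v = v' := by
  obtain ⟨s, -, hs⟩ := sqrtNegThreeTimesFivePlusSqrtFiveHalf_ratPrimeRule_exists_golden hR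
  have hx : ∀ w : HeightOneSpectrum (𝓞 (realField R)), s ^ 2 - s ∉ w.asIdeal := fun w h ↦
    w.isPrime.ne_top ((Ideal.eq_top_iff_one _).2 (by rwa [show s ^ 2 - s = 1 by rw [hs]; ring] at h))
  exact dyadic_unique_of_sq_sub_self_notMem (finrank_realField_quadratic hR) v v' h2 h2' (hx v) (hx v')

omit [Fact (Irreducible (cmPolyQ R))] in
/-- **The odd places of `θ` are harmless for a prime `ℓ ≠ 3` which is a square mod `5`** (`θ ∈ v ∌ 2 ⟹ 45 ∈ v ⟹ 3 ∈ v`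
— inert in `F`, residue field `𝔽₉` — or `5 ∈ v` — the place `(√5)`, `ℓ` a square there iff mod `5`). [folklore] -/
theorem sqrtNegThreeTimesFivePlusSqrtFiveHalf_ratPrimeRule_root_places (hR : R = X ^ 2 + C 15 * X + C 45)
    {θₒ : 𝓞 (realField R)} (hθ : (θₒ : realField R) = AdjoinRoot.root (realPolyQ R)) {ℓ : ℕ} (hℓ : ℓ.Prime)
    (hℓ3 : ℓ ≠ 3) (hℓ5 : ℓ ≠ 5) (hsq : IsSquare ((ℓ : ℤ) : ZMod 5)) :
    ∀ v : HeightOneSpectrum (𝓞 (realField R)), (2 : 𝓞 (realField R)) ∉ v.asIdeal → θₒ ∈ v.asIdeal →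
      (ℓ : 𝓞 (realField R)) ∉ v.asIdeal ∧
        (IsSquare (Ideal.Quotient.mk v.asIdeal (ℓ : 𝓞 (realField R))) ∨
          ¬ Odd (WithZero.log (v.valuation (realField R) ((θₒ : 𝓞 (realField R)) : realField R)))) := by
  have hnsq : ¬ IsSquare (((5 : ℤ) : ℤ) : ZMod 3) := by decide
  have hK := finrank_realField_quadratic hR
  obtain ⟨s, -, hs⟩ := sqrtNegThreeTimesFivePlusSqrtFiveHalf_ratPrimeRule_exists_sq_eq_five hR
  have hs' : s ^ 2 = ((5 : ℤ) : 𝓞 (realField R)) := by rw [hs]; norm_num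
  intro v h2 hθv
  have h45 : ((45 : ℤ) : 𝓞 (realField R)) ∈ v.asIdeal := intCast_mem_of_root_mem hR hθ v hθv
  have e : ((45 : ℤ) : 𝓞 (realField R)) = 3 * (3 * 5) := by push_cast; norm_num
  rw [e] at h45
  have h35 : (3 : 𝓞 (realField R)) ∈ v.asIdeal ∨ (5 : 𝓞 (realField R)) ∈ v.asIdeal := by
    rcases v.isPrime.mem_or_mem h45 with h | h
    · exact Or.inl h
    · exact v.isPrime.mem_or_mem h
  rcases h35 with h3v | h5v
  · obtain ⟨hℓv, hsqv⟩ := natCast_notMem_and_isSquare_of_inert_radicand hK hs' Nat.prime_three hnsq hℓ hℓ3 v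
      (by exact_mod_cast h3v)
    exact ⟨hℓv, Or.inl hsqv⟩
  · obtain ⟨hℓv, hsqv⟩ := radicand_places_of_isSquare_mod hK Nat.prime_five hℓ hℓ5 hsq v (by exact_mod_cast h5v)
    exact ⟨hℓv, Or.inl hsqv⟩

/-- **`[5] = [1]`** for `ℚ(√-3(5+√5)/2)`: `5 = ((2θ + 15)/3)²` is a square in `F`. [cite: Deligne1982HodgeCycles, §4 Cor. 4.2] -/
theorem sqrtNegThreeTimesFivePlusSqrtFiveHalf_ratPrimeRule_mk_five_eq_splitDiscriminantClassCM
    (hR : R = X ^ 2 + C 15 * X + C 45) (qℓ : (realField R)ˣ) (hq : (qℓ : realField R) = 5) {k : ℕ} (hk : Even k) :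
    (QuotientGroup.mk qℓ : cmNormResidueGroup R) = splitDiscriminantClassCM R k := by
  have hrel := root_rel_quadratic hR
  push_cast at hrel
  exact mk_eq_splitDiscriminantClassCM_of_eq_sq qℓ (x := (2 * AdjoinRoot.root (realPolyQ R) + 15) / 3)
    (by rw [hq]; field_simp; linear_combination -4 * hrel) hk

/-- **`[2] ≠ [1]` and `[3] ≠ [1]`** for `ℚ(√-3(5+√5)/2)`, read at the ramified place `v = (√5)`: `2` and `3` are
`v`-units and non-squares mod `v` (`𝓞_F/v = 𝔽₅`), and `ord_v θ = 1` (`θ² = 5·(θ + 6)²`, `(θ+6)(-θ-9) = -9 ∉ v`).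
[cite: Deligne1982HodgeCycles, §4 (1) and Cor. 4.2] [cite: Omeara1963, §63B Cor. 63:11a] -/
theorem sqrtNegThreeTimesFivePlusSqrtFiveHalf_ratPrimeRule_mk_ne_splitDiscriminantClassCM_of_dvd_six
    (hR : R = X ^ 2 + C 15 * X + C 45) {ℓ : ℕ} (hℓ : ℓ = 2 ∨ ℓ = 3)
    (qℓ : (realField R)ˣ) (hq : (qℓ : realField R) = ℓ) {k : ℕ} (hk : Even k) :
    (QuotientGroup.mk qℓ : cmNormResidueGroup R) ≠ splitDiscriminantClassCM R k := by
  have hK := finrank_realField_quadratic hR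
  have hnsq2 : ¬ IsSquare (((2 : ℕ) : ℤ) : ZMod 5) := by decide
  have hnsq3 : ¬ IsSquare (((3 : ℕ) : ℤ) : ZMod 5) := by decide
  obtain ⟨hRm, -⟩ := monic_and_natDegree_of_quadratic R hR
  obtain ⟨θₒ, hθ⟩ := exists_ringOfIntegers_coe_eq_root hRm
  have hrel := ringOfIntegers_root_rel_quadratic hR hθ
  push_cast at hrel
  obtain ⟨s, -, hs⟩ := sqrtNegThreeTimesFivePlusSqrtFiveHalf_ratPrimeRule_exists_sq_eq_five hR
  have hs' : s ^ 2 = (5 : ℕ) * 1 := by rw [hs]; norm_num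
  have hab : (0 : 𝓞 (realField R)) * (5 : ℕ) + 1 * 1 = 1 := by norm_num
  obtain ⟨v, h5v⟩ := exists_place_natCast_mem hK Nat.prime_five
  have hN := absNorm_eq_of_sq_eq_mul hK Nat.prime_five hs' hab v h5v
  have h5v' : ((5 : ℤ) : 𝓞 (realField R)) ∈ v.asIdeal := by exact_mod_cast h5v
  have h2v : (2 : 𝓞 (realField R)) ∉ v.asIdeal := by
    have := intCast_notMem_of_isCoprime v (show IsCoprime (5 : ℤ) 2 by norm_num) h5v'
    exact_mod_cast this
  have h3v : (3 : 𝓞 (realField R)) ∉ v.asIdeal := by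
    have := intCast_notMem_of_isCoprime v (show IsCoprime (5 : ℤ) 3 by norm_num) h5v'
    exact_mod_cast this
  have hm : θₒ + 6 ∉ v.asIdeal := fun h ↦ by
    have h9 : ((9 : ℤ) : 𝓞 (realField R)) ∈ v.asIdeal := by
      have e : ((9 : ℤ) : 𝓞 (realField R)) = -((θₒ + 6) * (-θₒ - 9)) + -(θₒ ^ 2 + 15 * θₒ + 45) := by push_cast; ring
      rw [e, hrel, neg_zero, add_zero]
      exact v.asIdeal.neg_mem (v.asIdeal.mul_mem_right _ h)
    exact intCast_notMem_of_isCoprime v (show IsCoprime (5 : ℤ) 9 by norm_num) h5v' h9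
  have hθm : θₒ ^ 2 = (5 : ℕ) * (θₒ + 6) ^ 2 := by push_cast; linear_combination (-4 : 𝓞 (realField R)) * hrel
  have hodd := odd_log_valuation_of_sq_eq_prime_mul_sq hK Nat.prime_five hs' hab v h5v hθm hm
  rcases hℓ with rfl | rfl
  · refine mk_natCast_ne_splitDiscriminantClassCM_of_ramified_place hθ v h2v (ℓ := 2) (by exact_mod_cast h2v) ?_ hodd qℓ
      hq hk
    have := (isSquare_intCast_residue_iff_of_absNorm_eq v Nat.prime_five hN 2).not.2 hnsq2
    push_cast at this
    exact this
  · refine mk_natCast_ne_splitDiscriminantClassCM_of_ramified_place hθ v h2v (ℓ := 3) (by exact_mod_cast h3v) ?_ hodd qℓ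
      hq hk
    have := (isSquare_intCast_residue_iff_of_absNorm_eq v Nat.prime_five hN 3).not.2 hnsq3
    push_cast at this
    exact this

/-- **THE RATIONAL PRIME RULE for `ℚ(√-3(5+√5)/2)`** (conductor `60`): for EVERY rational prime `ℓ` and even `k`, the row
`W_{2k}.E.[ℓ]` is non-split iff **`ℓ ≠ 5` and `ℓ mod 60 ∉ {1, 11, 19, 29}`** (`H = Gal(ℚ(ζ₆₀)/E) = {1, 11, 19, 29}`; the
split primes are decided by `(3|ℓ)·ε₅(ℓ)`). [cite: Deligne1982HodgeCycles, §4 (1) and Cor. 4.2]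
[cite: Omeara1963, §63B Example 63:12 and §71D Thm. 71:18] -/
theorem sqrtNegThreeTimesFivePlusSqrtFiveHalf_mk_prime_ne_splitDiscriminantClassCM_iff_mod
    (hR : R = X ^ 2 + C 15 * X + C 45) {ℓ : ℕ} (hℓ : ℓ.Prime) (qℓ : (realField R)ˣ) (hq : (qℓ : realField R) = ℓ)
    {k : ℕ} (hk : Even k) :
    (QuotientGroup.mk qℓ : cmNormResidueGroup R) ≠ splitDiscriminantClassCM R k ↔
      ℓ ≠ 5 ∧ ¬ (ℓ % 60 = 1 ∨ ℓ % 60 = 11 ∨ ℓ % 60 = 19 ∨ ℓ % 60 = 29) := by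
  by_cases h2 : ℓ = 2
  · subst h2
    exact iff_of_true (sqrtNegThreeTimesFivePlusSqrtFiveHalf_ratPrimeRule_mk_ne_splitDiscriminantClassCM_of_dvd_six hR
      (Or.inl rfl) qℓ hq hk) ⟨by omega, by omega⟩
  by_cases h3 : ℓ = 3
  · subst h3
    exact iff_of_true (sqrtNegThreeTimesFivePlusSqrtFiveHalf_ratPrimeRule_mk_ne_splitDiscriminantClassCM_of_dvd_six hR
      (Or.inr rfl) qℓ hq hk) ⟨by omega, by omega⟩
  by_cases h5 : ℓ = 5
  · subst h5
    exact iff_of_false (not_not.2 (sqrtNegThreeTimesFivePlusSqrtFiveHalf_ratPrimeRule_mk_five_eq_splitDiscriminantClassCM hR qℓ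
      (by rw [hq]; norm_num) hk)) (fun h ↦ h.1 rfl)
  by_cases hin : ℓ % 5 = 2 ∨ ℓ % 5 = 3
  · exact iff_of_true (sqrtNegThreeTimesFivePlusSqrtFiveHalf_ratPrimeRule_mk_prime_ne_splitDiscriminantClassCM_of_inert hR
      hℓ h2 h3 hin qℓ hq k) ⟨h5, by omega⟩
  have h5' : ℓ % 5 ≠ 0 := fun h ↦ h5 ((Nat.prime_dvd_prime_iff_eq Nat.prime_five hℓ).1 (Nat.dvd_of_mod_eq_zero h)).symm
  have hsp : ℓ % 5 = 1 ∨ ℓ % 5 = 4 := by omega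
  have hsq5 : IsSquare ((ℓ : ℤ) : ZMod 5) := by
    have sq1 : IsSquare ((1 : ℕ) : ZMod 5) := by decide
    have sq4 : IsSquare ((4 : ℕ) : ZMod 5) := by decide
    rw [Int.cast_natCast, ← ZMod.natCast_mod ℓ 5]
    rcases hsp with h | h <;> rw [h]
    · exact sq1
    · exact sq4
  haveI := Fact.mk hℓ
  obtain ⟨hRm, -⟩ := monic_and_natDegree_of_quadratic R hR
  obtain ⟨θₒ, hθ⟩ := exists_ringOfIntegers_coe_eq_root hRm
  have hroots := roots_real_neg_of_quadratic hR (by norm_num) (by norm_num) (by norm_num)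
  have hdisc : ¬ (ℓ : ℤ) ∣ (15 : ℤ) ^ 2 - 4 * 45 := fun h ↦ by
    have h' : ℓ ∣ 2 ^ 0 * 3 ^ 2 * 5 ^ 1 := by norm_num at h ⊢; exact_mod_cast h
    rcases eq_of_prime_dvd_two_pow_mul hℓ h' with rfl | rfl | rfl <;> omega
  have hℓq : ¬ (ℓ : ℤ) ∣ (45 : ℤ) := fun h ↦ by
    have h' : ℓ ∣ 2 ^ 0 * 3 ^ 2 * 5 ^ 1 := by norm_num; exact_mod_cast h
    rcases eq_of_prime_dvd_two_pow_mul hℓ h' with rfl | rfl | rfl <;> omega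
  have h30 : (3 : ZMod ℓ) ≠ 0 := by exact_mod_cast natCast_prime_ne_zero_zmod Nat.prime_three h3
  have hdsq : IsSquare (((15 : ℤ) ^ 2 - 4 * 45 : ℤ) : ZMod ℓ) := by
    push_cast
    rw [show (45 : ZMod ℓ) = 5 * 3 ^ 2 by norm_num, isSquare_mul_sq_iff_of_ne_zero h30, isSquare_five_iff h2 h5]
    exact hsp
  rw [mk_natCast_ne_splitDiscriminantClassCM_iff_of_root_character hR hroots hθ
    (sqrtNegThreeTimesFivePlusSqrtFiveHalf_ratPrimeRule_dyadic_unique hR) hℓ h2 hℓq hdisc hdsq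
    (sqrtNegThreeTimesFivePlusSqrtFiveHalf_ratPrimeRule_root_places hR hθ hℓ h3 h5 hsq5)
    (fun r hr ↦ isSquare_root_iff_cond60 h2 h3 h5 r (by push_cast at hr; exact hr)) qℓ hq hk]
  have hodd : ℓ % 2 = 1 := (Nat.Prime.mod_two_eq_one_iff_ne_two hℓ).2 h2
  have h3' : ℓ % 3 ≠ 0 := fun h ↦ h3 ((Nat.prime_dvd_prime_iff_eq Nat.prime_three hℓ).1 (Nat.dvd_of_mod_eq_zero h)).symm
  have key : ∀ n : ℕ, n % 2 = 1 → n % 3 ≠ 0 → (n % 5 = 1 ∨ n % 5 = 4) →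
      (¬ ((n % 12 = 1 ∨ n % 12 = 11) ↔ n % 5 = 1) ↔ (n ≠ 5 ∧ ¬ (n % 60 = 1 ∨ n % 60 = 11 ∨ n % 60 = 19 ∨ n % 60 = 29))) := by
    intro n hn0 hn3 hn1
    obtain ⟨k', r, hr, rfl⟩ : ∃ k' r, r < 60 ∧ n = 60 * k' + r :=
      ⟨n / 60, n % 60, Nat.mod_lt _ (by norm_num), (Nat.div_add_mod n 60).symm⟩
    interval_cases r <;> omega
  exact key ℓ hodd h3' hsp

/-- Equivalently: **`[ℓ] = [1] ⟺ ℓ = 5 ∨ ℓ mod 60 ∈ {1, 11, 19, 29}`** (`ℚ(√-3(5+√5)/2)`, every prime `ℓ`, even `k`).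
[cite: Deligne1982HodgeCycles, §4 (1) and Cor. 4.2] -/
theorem sqrtNegThreeTimesFivePlusSqrtFiveHalf_mk_prime_eq_splitDiscriminantClassCM_iff_mod
    (hR : R = X ^ 2 + C 15 * X + C 45) {ℓ : ℕ} (hℓ : ℓ.Prime) (qℓ : (realField R)ˣ) (hq : (qℓ : realField R) = ℓ)
    {k : ℕ} (hk : Even k) :
    (QuotientGroup.mk qℓ : cmNormResidueGroup R) = splitDiscriminantClassCM R k ↔
      ℓ = 5 ∨ (ℓ % 60 = 1 ∨ ℓ % 60 = 11 ∨ ℓ % 60 = 19 ∨ ℓ % 60 = 29) := by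
  have h := sqrtNegThreeTimesFivePlusSqrtFiveHalf_mk_prime_ne_splitDiscriminantClassCM_iff_mod hR hℓ qℓ hq hk
  tauto

end Cond60

/-! ### §65 `E = ℚ(ζ₅)` (`R = S² + 5S + 5`, `F = ℚ(√5)`, conductor `5`): `[ℓ] = [1] ⟺ ℓ = 5 ∨ ℓ ≡ 1 (mod 5)` -/

section Cond5

omit [Fact (Irreducible (cmPolyQ R))] in
/-- `√5 = 2θ + 5` is an algebraic integer of `F` with square `5`. [folklore] -/
theorem zeta5_ratPrimeRule_exists_sq_eq_five (hR : R = X ^ 2 + C 5 * X + C 5) :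
    ∃ s : 𝓞 (realField R), (s : realField R) = 2 * AdjoinRoot.root (realPolyQ R) + 5 ∧ s ^ 2 = 5 := by
  have hrel := root_rel_quadratic hR
  push_cast at hrel
  have hsq : (2 * AdjoinRoot.root (realPolyQ R) + 5) ^ 2 = (5 : realField R) := by linear_combination 4 * hrel
  have hint : IsIntegral ℤ (2 * AdjoinRoot.root (realPolyQ R) + 5 : realField R) := by
    refine ⟨X ^ 2 - C 5, by monicity!, ?_⟩
    rw [eval₂_sub, eval₂_X_pow, eval₂_C]
    simp only [eq_intCast, Int.cast_ofNat]
    linear_combination hsq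
  refine ⟨⟨_, hint⟩, rfl, ?_⟩
  refine RingOfIntegers.ext ?_
  simp only [map_pow, map_ofNat]
  exact hsq

omit [Fact (Irreducible (cmPolyQ R))] in
/-- The golden integer `ω = (1 + √5)/2 = θ + 3 ∈ 𝓞_F`: `ω² = ω + 1`. [folklore] -/
theorem zeta5_ratPrimeRule_exists_golden (hR : R = X ^ 2 + C 5 * X + C 5) :
    ∃ s : 𝓞 (realField R), (s : realField R) = AdjoinRoot.root (realPolyQ R) + 3 ∧ s ^ 2 = s + 1 := by
  have hrel := root_rel_quadratic hR
  push_cast at hrel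
  have hsq : (AdjoinRoot.root (realPolyQ R) + 3) ^ 2 = AdjoinRoot.root (realPolyQ R) + 3 + (1 : realField R) := by
    linear_combination hrel
  have hint : IsIntegral ℤ (AdjoinRoot.root (realPolyQ R) + 3 : realField R) := by
    refine ⟨X ^ 2 - X - C 1, by monicity!, ?_⟩
    rw [eval₂_sub, eval₂_sub, eval₂_X_pow, eval₂_X, eval₂_C]
    simp only [eq_intCast, Int.cast_one]
    linear_combination hsq
  refine ⟨⟨_, hint⟩, rfl, ?_⟩
  refine RingOfIntegers.ext ?_
  simp only [map_pow, map_add, map_one]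
  exact hsq

omit [Fact (Irreducible (cmPolyQ R))] in
/-- **`F = ℚ(√5)` has exactly one dyadic place** (in this carrier's terms). [folklore] -/
theorem zeta5_ratPrimeRule_dyadic_unique (hR : R = X ^ 2 + C 5 * X + C 5)
    (v v' : HeightOneSpectrum (𝓞 (realField R))) (h2 : (2 : 𝓞 (realField R)) ∈ v.asIdeal)
    (h2' : (2 : 𝓞 (realField R)) ∈ v'.asIdeal) : v = v' := by
  obtain ⟨s, -, hs⟩ := zeta5_ratPrimeRule_exists_golden hR
  have hx : ∀ w : HeightOneSpectrum (𝓞 (realField R)), s ^ 2 - s ∉ w.asIdeal := fun w h ↦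
    w.isPrime.ne_top ((Ideal.eq_top_iff_one _).2 (by rwa [show s ^ 2 - s = 1 by rw [hs]; ring] at h))
  exact dyadic_unique_of_sq_sub_self_notMem (finrank_realField_quadratic hR) v v' h2 h2' (hx v) (hx v')

omit [Fact (Irreducible (cmPolyQ R))] in
/-- **The odd places of `θ` are harmless for a prime `ℓ` which is a square mod `5`** (`θ ∈ v ⟹ 5 ∈ v`). [folklore] -/
theorem zeta5_ratPrimeRule_root_places (hR : R = X ^ 2 + C 5 * X + C 5)
    {θₒ : 𝓞 (realField R)} (hθ : (θₒ : realField R) = AdjoinRoot.root (realPolyQ R)) {ℓ : ℕ} (hℓ : ℓ.Prime)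
    (hℓ5 : ℓ ≠ 5) (hsq : IsSquare ((ℓ : ℤ) : ZMod 5)) :
    ∀ v : HeightOneSpectrum (𝓞 (realField R)), (2 : 𝓞 (realField R)) ∉ v.asIdeal → θₒ ∈ v.asIdeal →
      (ℓ : 𝓞 (realField R)) ∉ v.asIdeal ∧
        (IsSquare (Ideal.Quotient.mk v.asIdeal (ℓ : 𝓞 (realField R))) ∨
          ¬ Odd (WithZero.log (v.valuation (realField R) ((θₒ : 𝓞 (realField R)) : realField R)))) := by
  intro v _ hθv
  have h5v : ((5 : ℤ) : 𝓞 (realField R)) ∈ v.asIdeal := intCast_mem_of_root_mem hR hθ v hθv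
  obtain ⟨hℓv, hsqv⟩ := radicand_places_of_isSquare_mod (finrank_realField_quadratic hR) Nat.prime_five hℓ hℓ5 hsq v
    (by exact_mod_cast h5v)
  exact ⟨hℓv, Or.inl hsqv⟩

/-- **`[5] = [1]`** for `ℚ(ζ₅)` (any even `k`): `5 = (2θ + 5)²`. [cite: Deligne1982HodgeCycles, §4 Cor. 4.2] -/
theorem zeta5_ratPrimeRule_mk_five_eq_splitDiscriminantClassCM (hR : R = X ^ 2 + C 5 * X + C 5)
    (qℓ : (realField R)ˣ) (hq : (qℓ : realField R) = 5) {k : ℕ} (hk : Even k) :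
    (QuotientGroup.mk qℓ : cmNormResidueGroup R) = splitDiscriminantClassCM R k := by
  have hrel := root_rel_quadratic hR
  push_cast at hrel
  exact mk_eq_splitDiscriminantClassCM_of_eq_sq qℓ (x := 2 * AdjoinRoot.root (realPolyQ R) + 5)
    (by rw [hq]; linear_combination -4 * hrel) hk

/-- **`[2] ≠ [1]`** for `ℚ(ζ₅)` (any even `k`), read at the ramified place `v = (√5)`: `2` is a non-square in
`𝓞_F/v = 𝔽₅` and `ord_v θ = 1` (`θ² = 5·(θ + 2)²`, `(θ+2)(-θ-3) = -1`) — gen 47's ramified descent, by the uniform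
route. [cite: Deligne1982HodgeCycles, §4 (1) and Cor. 4.2] [cite: Omeara1963, §63B Cor. 63:11a] -/
theorem zeta5_ratPrimeRule_mk_two_ne_splitDiscriminantClassCM (hR : R = X ^ 2 + C 5 * X + C 5)
    (qℓ : (realField R)ˣ) (hq : (qℓ : realField R) = 2) {k : ℕ} (hk : Even k) :
    (QuotientGroup.mk qℓ : cmNormResidueGroup R) ≠ splitDiscriminantClassCM R k := by
  have hK := finrank_realField_quadratic hR
  have hnsq : ¬ IsSquare (((2 : ℕ) : ℤ) : ZMod 5) := by decide
  obtain ⟨hRm, -⟩ := monic_and_natDegree_of_quadratic R hR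
  obtain ⟨θₒ, hθ⟩ := exists_ringOfIntegers_coe_eq_root hRm
  have hrel := ringOfIntegers_root_rel_quadratic hR hθ
  push_cast at hrel
  obtain ⟨s, -, hs⟩ := zeta5_ratPrimeRule_exists_sq_eq_five hR
  have hs' : s ^ 2 = (5 : ℕ) * 1 := by rw [hs]; norm_num
  have hab : (0 : 𝓞 (realField R)) * (5 : ℕ) + 1 * 1 = 1 := by norm_num
  obtain ⟨v, h5v⟩ := exists_place_natCast_mem hK Nat.prime_five
  have hN := absNorm_eq_of_sq_eq_mul hK Nat.prime_five hs' hab v h5v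
  have h5v' : ((5 : ℤ) : 𝓞 (realField R)) ∈ v.asIdeal := by exact_mod_cast h5v
  have h2v : (2 : 𝓞 (realField R)) ∉ v.asIdeal := by
    have := intCast_notMem_of_isCoprime v (show IsCoprime (5 : ℤ) 2 by norm_num) h5v'
    exact_mod_cast this
  have hm : θₒ + 2 ∉ v.asIdeal := fun h ↦ by
    refine v.isPrime.ne_top ((Ideal.eq_top_iff_one _).2 ?_)
    have e : (1 : 𝓞 (realField R)) = -((θₒ + 2) * (-θₒ - 3)) - (θₒ ^ 2 + 5 * θₒ + 5) := by ring
    rw [e, hrel, sub_zero]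
    exact v.asIdeal.neg_mem (v.asIdeal.mul_mem_right _ h)
  have hθm : θₒ ^ 2 = (5 : ℕ) * (θₒ + 2) ^ 2 := by push_cast; linear_combination (-4 : 𝓞 (realField R)) * hrel
  have hodd := odd_log_valuation_of_sq_eq_prime_mul_sq hK Nat.prime_five hs' hab v h5v hθm hm
  refine mk_natCast_ne_splitDiscriminantClassCM_of_ramified_place hθ v h2v (ℓ := 2) (by exact_mod_cast h2v) ?_ hodd qℓ
    (by rw [hq]; norm_num) hk
  have := (isSquare_intCast_residue_iff_of_absNorm_eq v Nat.prime_five hN 2).not.2 hnsq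
  push_cast at this
  exact this

/-- **THE RATIONAL PRIME RULE for `ℚ(ζ₅)` by the uniform route** (any even `k`): for EVERY rational prime `ℓ`,
**`[ℓ] = [(-1)^k] ⟺ ℓ = 5 ∨ ℓ ≡ 1 (mod 5)`** (`H = Gal(ℚ(ζ₅)/E) = {1}`) — b03.16's classification (there by Thue's
lemma, the quartic norm form and peeling) re-derived from the local symbols: inert `ℓ ≡ ±2` (part 21), split
`ℓ ≡ 4` by `ε₅` (parts 22–23), `[2]` at `(√5)`, `[5] = [(√5)²]`. [cite: Deligne1982HodgeCycles, §4 (1) and Cor. 4.2]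
[cite: Omeara1963, §63B Example 63:12 and §71D Thm. 71:18] -/
theorem zeta5_ratPrimeRule_mk_prime_eq_splitDiscriminantClassCM_iff_mod (hR : R = X ^ 2 + C 5 * X + C 5)
    {ℓ : ℕ} (hℓ : ℓ.Prime) (qℓ : (realField R)ˣ) (hq : (qℓ : realField R) = ℓ) {k : ℕ} (hk : Even k) :
    (QuotientGroup.mk qℓ : cmNormResidueGroup R) = splitDiscriminantClassCM R k ↔ ℓ = 5 ∨ ℓ % 5 = 1 := by
  by_cases h2 : ℓ = 2
  · subst h2
    exact iff_of_false (zeta5_ratPrimeRule_mk_two_ne_splitDiscriminantClassCM hR qℓ (by rw [hq]; norm_num) hk) (by omega)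
  by_cases h5 : ℓ = 5
  · subst h5
    exact iff_of_true (zeta5_ratPrimeRule_mk_five_eq_splitDiscriminantClassCM hR qℓ (by rw [hq]; norm_num) hk) (Or.inl rfl)
  by_cases hin : ℓ % 5 = 2 ∨ ℓ % 5 = 3
  · exact iff_of_false (zeta5_ratPrimeRule_mk_prime_ne_splitDiscriminantClassCM_of_inert hR hℓ h2 hin qℓ hq k) (by omega)
  have h5' : ℓ % 5 ≠ 0 := fun h ↦ h5 ((Nat.prime_dvd_prime_iff_eq Nat.prime_five hℓ).1 (Nat.dvd_of_mod_eq_zero h)).symm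
  have hsp : ℓ % 5 = 1 ∨ ℓ % 5 = 4 := by omega
  have hsq5 : IsSquare ((ℓ : ℤ) : ZMod 5) := by
    have sq1 : IsSquare ((1 : ℕ) : ZMod 5) := by decide
    have sq4 : IsSquare ((4 : ℕ) : ZMod 5) := by decide
    rw [Int.cast_natCast, ← ZMod.natCast_mod ℓ 5]
    rcases hsp with h | h <;> rw [h]
    · exact sq1
    · exact sq4
  haveI := Fact.mk hℓ
  obtain ⟨hRm, -⟩ := monic_and_natDegree_of_quadratic R hR
  obtain ⟨θₒ, hθ⟩ := exists_ringOfIntegers_coe_eq_root hRm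
  have hroots := roots_real_neg_of_quadratic hR (by norm_num) (by norm_num) (by norm_num)
  have hdisc : ¬ (ℓ : ℤ) ∣ (5 : ℤ) ^ 2 - 4 * 5 := fun h ↦ by
    have h' : ℓ ∣ 2 ^ 0 * 3 ^ 0 * 5 ^ 1 := by norm_num at h ⊢; exact_mod_cast h
    rcases eq_of_prime_dvd_two_pow_mul hℓ h' with rfl | rfl | rfl <;> omega
  have hℓq : ¬ (ℓ : ℤ) ∣ (5 : ℤ) := fun h ↦ by
    have h' : ℓ ∣ 2 ^ 0 * 3 ^ 0 * 5 ^ 1 := by norm_num; exact_mod_cast h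
    rcases eq_of_prime_dvd_two_pow_mul hℓ h' with rfl | rfl | rfl <;> omega
  have hdsq : IsSquare (((5 : ℤ) ^ 2 - 4 * 5 : ℤ) : ZMod ℓ) := by
    push_cast
    rw [isSquare_five_iff h2 h5]
    exact hsp
  have h := mk_natCast_ne_splitDiscriminantClassCM_iff_of_root_character hR hroots hθ (zeta5_ratPrimeRule_dyadic_unique hR)
    hℓ h2 hℓq hdisc hdsq (zeta5_ratPrimeRule_root_places hR hθ hℓ h5 hsq5)
    (fun r hr ↦ isSquare_root_iff_cond5 h2 h5 r (by push_cast at hr; exact hr)) qℓ hq hk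
  rw [(not_iff_not.1 h : (QuotientGroup.mk qℓ : cmNormResidueGroup R) = splitDiscriminantClassCM R k ↔ ℓ % 5 = 1)]
  exact ⟨fun hx ↦ Or.inr hx, fun hx ↦ hx.resolve_left h5⟩

end Cond5

end Summit.HodgeConjecture.HodgeConjecture.Ring2.WeilCoverageCM

end
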